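import Summits.CriticalPhenomena.PercolationContinuityZ3.Theses.PercDiodeSteering
import Literature.Probability.LatticeModels.LupuCouplingAnnealed

/-!
# Birth skeleton (BC3) for the crux `BackboneSteering` (stmt-CriticalPhenomena-7548)

Route `route-CriticalPhenomena-PercDiodeSteering` (sub-problem `PercolationContinuityZ3`), crux decl
`Summit.CriticalPhenomena.PercolationContinuityZ3.Theses.PercDiodeSteering.BackboneSteering` (rank 2):
in the resistor–diode network (RDN) on `ℤ³` with i.i.d. uniform labels `U` (law `labelMeasure`),
forward step `x ⋖ z` passable iff `U ≤ p`, backward step iff `U ≤ p·r`, forward percolation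
probability `θ⁺(p,r)`; for every ratio `0 ≤ r < 1` and every `p` with SUBCRITICAL RESISTOR BACKBONE
`p·r < p_c(ℤ³)`: `0 < θ⁺(p,r) → ∃ p' < p, 0 < θ⁺(p',r)` (forward percolation is an open condition
downward in `p` on the directed side of Redner's diagram).

THE LINE = the route header's own foreseen glued split
"BackboneSteering ⇐ TimeLikeCone → ConeSteeringCriterion → BackboneSteering" (TWO-LAYER PLAN of
`Theses/PercDiodeSteering.lean`), typed. Write `h(y) := y₀ + y₁ + y₂` for the HEIGHT (a forward step
raises it by `1`, a backward step lowers it by `1`), `D(p,r;x,n) := {U | ∃ y, x →⁺ y, h(y) ≤ h(x) − n}`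
for the NET-BACKWARD EXCURSION EVENT of depth `n` of the forward cluster of `x`, and call `(p,r)`
TIME-LIKE if `μ(D(p,r;0,n)) ≤ C e^{−c n}` (`TimeLike`), uniformly time-like if the same bound holds
for every base point `x` (`UniformTimeLike`). A DIRECTED-SIDE CRITICAL POINT of ratio `r` is a `p` with
`IsGLB {q | 0 < θ⁺(q,r)} p` (i.e. `p = p_c(r)`; stated as a greatest lower bound and NOT as
"`θ⁺ = 0` below `p` and `θ⁺(p,r) > 0`", which would make the stubs vacuous in a world where the crux
holds) — the only place where the crux has content (above `p_c(r)` the conclusion is the definition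
of an infimum, below it the hypothesis `0 < θ⁺` fails).

* STUB 1 `stub_timeLikeCone` (OPEN — LOAD-BEARING; L for `r ≤ 1/36` by path counting, open-problem
  as `r ↑ 1`): **at a directed-side critical point with subcritical backbone the forward cluster is
  time-like** — `IsGLB {q | 0 < θ⁺(q,r)} p → p·r < p_c(ℤ³) → TimeLike p r`. This is the DP-class
  anisotropy input of the card ("the cone constant must come from DP-class anisotropy, not from
  sharpness of the backbone"): in phase-diagram terms, the non-percolating/forward boundary `a_c(b)`
  and the forward/two-way boundary `a_I(b)` of Redner's diagram stay strictly apart for every diode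
  density `b > 0` and the backward ("zig-zag": down two resistors, up one diode) process is sharp at
  `a_c(b)`. By monotonicity of `D` in `p` (`backEvent_mono`, proved) time-likeness at `p_c(r)` is
  time-likeness on the whole segment below it, so nothing subcritical is added. NOT claimed above
  `p_c(r)`: at `p = 1`, `a = 0.24 < p_c` the first-moment count of down-2-up-1 zig-zags is
  `27·p·a² ≈ 1.55 > 1`, and the forward cluster plausibly makes unbounded net-backward excursions —
  this is exactly the crux's recorded failure mode ("diode + lone-resistor chains go net-backward at
  every scale", Grimmett1999 p.162), confined here to where it belongs. Why it might fail: for `r`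
  close to `1` the backbone is near-critical (`a = r·p_c(r) → p_c`), backward excursions of depth
  `ξ(a)` are cheap, and no path counting closes; a direct N–I transition segment `r ∈ (r*,1)` would
  make it false there (physics says `r* = 1`: JanssenStenull2000, ZhouEtAl2012, Redner1982).
* STUB 2 `stub_coneSteering` (OPEN, XL — the Grimmett–Hiemer transplant): **at a uniformly
  time-like directed-side critical point with subcritical backbone there is no forward percolation**
  — `IsGLB {q | 0 < θ⁺(q,r)} p → p·r < p_c(ℤ³) → UniformTimeLike p r → θ⁺(p,r) = 0`. Same-parameter
  (steering) dynamic renormalisation as in GrimmettHiemer2002 Thm 1 (`r = 0`, where time-likeness is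
  automatic) / BezuidenhoutGrimmett1990: if `θ⁺(p,r) > 0`, block events of a finite-size criterion
  hold w.h.p. at `p` (seeds harvested from the infinite forward cluster), blocks fattened by collars
  of width `C' log L` are never re-entered (union bound from `UniformTimeLike`: `(2L+1)³·C·L^{−cC'}`),
  the criterion is continuous in `p` (finite box), and its sufficiency gives `θ⁺(p',r) > 0` for some
  `p' < p`, contradicting the lower-bound half of `IsGLB`. It is a CONSEQUENCE of the crux
  (`coneSteering_of_backboneSteering`, proved: the crux weakened by the time-likeness hypothesis),
  hence refutable only together with the crux (route KILL CRITERIA: `refuted:BackboneSteering`).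
  Why it might fail: even at `r = 0` the conventional `(1,1,1)` bond model is covered in print only by
  GH02's adaptation remark; for `r > 0` the seeds of the next block must provably avoid every examined
  edge although forward paths re-enter collars, and FKG-positive information from the explored
  cluster is not dominated by the fresh measure.

Composition (kernel-checked, no `sorry`): `BackboneSteering_of : Sig.stub_timeLikeCone →
Sig.stub_coneSteering → BackboneSteering`. Given `r, p` with `p·r < p_c` and `0 < θ⁺(p,r)`, suppose no
`p' < p` percolates; then `p` is a greatest lower bound of `{q | 0 < θ⁺(q,r)}` (it is a member and a
lower bound), STUB 1 makes `(p,r)` time-like, TRANSLATION INVARIANCE OF THE RDN LAW (proved here: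
`measure_backEvent_shift`, from `labelMeasure_map_comp_equiv` and the equivariance of forward reach
under lattice shifts, `reach_shiftLabels`) makes it uniformly time-like, and STUB 2 gives
`θ⁺(p,r) = 0`, a contradiction. The stub statements are DEFINITION-FREE (`let θ …; let D …` over
`labelMeasure`, `Site 3`, `CovBy`, `Relation.ReflTransGen`, `criticalProb (zdGraph 3) 0`, exactly the
crux's own `let θ`), so a `--supports` file can restate them verbatim without importing this file;
`Sig.stub_*_iff` (`Iff.rfl`) identify them with the readable local forms `TimeLikeCone`,
`ConeSteering`.

DISPROOF USED: none exists for this crux (`ledger crux ls stmt-CriticalPhenomena-7548`: no workfiles,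
no `Disproof.lean`, no landed `Negative/` lemma, 2026-08-17). Negatives index (`ledger negatives
--problem CriticalPhenomena`, 11 refuted statements): nothing on oriented / partially oriented
percolation or the resistor–diode network. Dead lines: none registered for this crux. Degenerate
instances checked: `r = 0` (backward steps need `U ≤ 0`, a null event: STUB 1 trivial, STUB 2 = GH02
Thm 1 for the conventional bond model up to null sets); `p ≤ 0` (`θ⁺ = 0`, `D` null for `n ≥ 1`);
`p > 1` is never a greatest lower bound (`θ⁺(1,r) = 1`); `n = 0` forces `C ≥ 1` only.
-/

noncomputable section

namespace Summit.CriticalPhenomena.PercolationContinuityZ3.Cruxes.BackboneSteering.Birth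

open MeasureTheory Literature.Probability.Percolation Literature.Probability.LatticeModels
open scoped BigOperators
open Summit.CriticalPhenomena.PercolationContinuityZ3.Theses.PercDiodeSteering (BackboneSteering)

/-! ## §0 Objects of the line -/

/-- The law of the i.i.d. uniform labels on the bonds of `ℤ³` (all of `Sym2 (Site 3)`). -/
abbrev μ : Measure (Labels 3) := labelMeasure (Site 3)

/-- The step relation of the resistor–diode network at `(p, r)`: forward (`u ⋖ v`, i.e. `v = u + eᵢ`)
iff `U ≤ p`, backward iff `U ≤ p·r` (verbatim the relation inside the crux's `let θ`). -/
def step (p r : ℝ) (U : Labels 3) (u v : Site 3) : Prop :=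
  (u ⋖ v ∧ U s(u, v) ≤ p) ∨ (v ⋖ u ∧ U s(u, v) ≤ p * r)

/-- Forward reachability `x →⁺ y` at `(p, r)`. -/
def reach (p r : ℝ) (U : Labels 3) : Site 3 → Site 3 → Prop := Relation.ReflTransGen (step p r U)

/-- `θ⁺(p, r)`: the forward cluster of the origin is infinite. -/
def thetaRD (p r : ℝ) : ℝ := μ.real {U | {y : Site 3 | reach p r U 0 y}.Infinite}

/-- `p_c(ℤ³)` (bond). -/
abbrev pcZ3 : ℝ := criticalProb (zdGraph 3) 0

/-- The crux, literally, over the local names. -/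
theorem backboneSteering_iff :
    BackboneSteering ↔ ∀ r : ℝ, 0 ≤ r → r < 1 → ∀ p : ℝ, p * r < pcZ3 → 0 < thetaRD p r →
      ∃ p' < p, 0 < thetaRD p' r :=
  Iff.rfl

/-- The height `h(y) = y₀ + y₁ + y₂`: `+1` along a forward step, `−1` along a backward step. -/
def height (y : Site 3) : ℤ := ∑ i, y i

/-- The net-backward excursion event of depth `n` from the base point `x`:
some `y` with `x →⁺ y` and `h(y) ≤ h(x) − n`. -/
def backEvent (p r : ℝ) (x : Site 3) (n : ℕ) : Set (Labels 3) :=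
  {U | ∃ y : Site 3, reach p r U x y ∧ height y + n ≤ height x}

/-- `(p, r)` is TIME-LIKE: net-backward excursions of the forward cluster of the origin have
exponential tails. -/
def TimeLike (p r : ℝ) : Prop :=
  ∃ C c : ℝ, 0 < c ∧ ∀ n : ℕ, μ.real (backEvent p r 0 n) ≤ C * Real.exp (-(c * n))

/-- Uniformly time-like: the same bound from every base point (what the block argument consumes). -/
def UniformTimeLike (p r : ℝ) : Prop :=
  ∃ C c : ℝ, 0 < c ∧ ∀ (x : Site 3) (n : ℕ), μ.real (backEvent p r x n) ≤ C * Real.exp (-(c * n))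

/-- `p` is THE directed-side critical point of ratio `r`: the greatest lower bound of the
forward-percolating parameters (`p = p_c(r)`, whether or not `p` itself percolates). -/
def IsCritical (p r : ℝ) : Prop := IsGLB {q : ℝ | 0 < thetaRD q r} p

/-! ## §1 The two stub statements — readable local form -/

/-- STUB 1 statement: at a directed-side critical point with subcritical backbone, time-likeness. -/
def TimeLikeCone : Prop :=
  ∀ r : ℝ, 0 ≤ r → r < 1 → ∀ p : ℝ, IsCritical p r → p * r < pcZ3 → TimeLike p r

/-- STUB 2 statement: at a uniformly time-like directed-side critical point with subcritical
backbone, no forward percolation (Grimmett–Hiemer transplanted). -/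
def ConeSteering : Prop :=
  ∀ r : ℝ, 0 ≤ r → r < 1 → ∀ p : ℝ, IsCritical p r → p * r < pcZ3 → UniformTimeLike p r →
    thetaRD p r = 0

/-! ### Name-keyed, DEFINITION-FREE forms (what `BackboneSteering_of` takes; restatable verbatim) -/

namespace Sig

/-- Name-keyed statement of `stub_timeLikeCone`, definition-free (`θ` = the crux's own `let θ`;
`D p r x n` = the net-backward excursion event of depth `n` from `x`). [stub statement; open] -/
def stub_timeLikeCone : Prop :=
  let θ : ℝ → ℝ → ℝ := fun p r => (labelMeasure (Site 3)).real
    {U | {y : Site 3 | Relation.ReflTransGen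
      (fun u v : Site 3 => (u ⋖ v ∧ U s(u, v) ≤ p) ∨ (v ⋖ u ∧ U s(u, v) ≤ p * r)) 0 y}.Infinite}
  let D : ℝ → ℝ → Site 3 → ℕ → Set (Sym2 (Site 3) → ℝ) := fun p r x n =>
    {U | ∃ y : Site 3, Relation.ReflTransGen
      (fun u v : Site 3 => (u ⋖ v ∧ U s(u, v) ≤ p) ∨ (v ⋖ u ∧ U s(u, v) ≤ p * r)) x y ∧
      (∑ i, y i) + n ≤ ∑ i, x i}
  ∀ r : ℝ, 0 ≤ r → r < 1 → ∀ p : ℝ, IsGLB {q : ℝ | 0 < θ q r} p →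
    p * r < criticalProb (zdGraph 3) 0 →
    ∃ C c : ℝ, 0 < c ∧ ∀ n : ℕ, (labelMeasure (Site 3)).real (D p r 0 n) ≤ C * Real.exp (-(c * n))

/-- Name-keyed statement of `stub_coneSteering`, definition-free. [stub statement; open] -/
def stub_coneSteering : Prop :=
  let θ : ℝ → ℝ → ℝ := fun p r => (labelMeasure (Site 3)).real
    {U | {y : Site 3 | Relation.ReflTransGen
      (fun u v : Site 3 => (u ⋖ v ∧ U s(u, v) ≤ p) ∨ (v ⋖ u ∧ U s(u, v) ≤ p * r)) 0 y}.Infinite}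
  let D : ℝ → ℝ → Site 3 → ℕ → Set (Sym2 (Site 3) → ℝ) := fun p r x n =>
    {U | ∃ y : Site 3, Relation.ReflTransGen
      (fun u v : Site 3 => (u ⋖ v ∧ U s(u, v) ≤ p) ∨ (v ⋖ u ∧ U s(u, v) ≤ p * r)) x y ∧
      (∑ i, y i) + n ≤ ∑ i, x i}
  ∀ r : ℝ, 0 ≤ r → r < 1 → ∀ p : ℝ, IsGLB {q : ℝ | 0 < θ q r} p →
    p * r < criticalProb (zdGraph 3) 0 →
    (∃ C c : ℝ, 0 < c ∧ ∀ (x : Site 3) (n : ℕ),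
      (labelMeasure (Site 3)).real (D p r x n) ≤ C * Real.exp (-(c * n))) →
    θ p r = 0

end Sig

/-- The name-keyed form of STUB 1 is the local form. -/
theorem Sig.stub_timeLikeCone_iff : Sig.stub_timeLikeCone ↔ TimeLikeCone := Iff.rfl

/-- The name-keyed form of STUB 2 is the local form. -/
theorem Sig.stub_coneSteering_iff : Sig.stub_coneSteering ↔ ConeSteering := Iff.rfl

/-! ## §2 Registered stubs (the only `sorry`s of the file) -/

/-- **STUB 1 `timeLikeCone`** (OPEN — LOAD-BEARING). For `0 ≤ r < 1` and `p` the greatest lower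
bound of `{q | 0 < θ⁺(q,r)}` with `p·r < p_c(ℤ³)`: there are `C` and `c > 0` with
`μ(∃ y, 0 →⁺ y, y₀+y₁+y₂ ≤ −n) ≤ C·e^{−c n}` for all `n` (the critical forward cluster is time-like).
First lemma (path counting, the `r ≤ 1/36` rung): a self-avoiding forward path of net backward
progress `n` has at least `n` backward steps, `P ≤ Σ_{k ≥ n} N_k (p r)^k p^{k−n}`-type bounds give
`c = −log(6√(p r·p)) − …` when `36·p·r·p < 1`. Why it might fail: see the module docstring
(near-critical backbone as `r ↑ 1`). [GrimmettHiemer2002; BezuidenhoutGrimmett1990; Redner1982;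
JanssenStenull2000; ZhouEtAl2012; Grimmett1999 p.162] -/
theorem stub_timeLikeCone :
    let θ : ℝ → ℝ → ℝ := fun p r => (labelMeasure (Site 3)).real
      {U | {y : Site 3 | Relation.ReflTransGen
        (fun u v : Site 3 => (u ⋖ v ∧ U s(u, v) ≤ p) ∨ (v ⋖ u ∧ U s(u, v) ≤ p * r)) 0 y}.Infinite}
    let D : ℝ → ℝ → Site 3 → ℕ → Set (Sym2 (Site 3) → ℝ) := fun p r x n =>
      {U | ∃ y : Site 3, Relation.ReflTransGen
        (fun u v : Site 3 => (u ⋖ v ∧ U s(u, v) ≤ p) ∨ (v ⋖ u ∧ U s(u, v) ≤ p * r)) x y ∧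
        (∑ i, y i) + n ≤ ∑ i, x i}
    ∀ r : ℝ, 0 ≤ r → r < 1 → ∀ p : ℝ, IsGLB {q : ℝ | 0 < θ q r} p →
      p * r < criticalProb (zdGraph 3) 0 →
      ∃ C c : ℝ, 0 < c ∧ ∀ n : ℕ,
        (labelMeasure (Site 3)).real (D p r 0 n) ≤ C * Real.exp (-(c * n)) := by
  sorry

/-- **STUB 2 `coneSteering`** (OPEN, XL — Grimmett–Hiemer transplanted to the time-like partially
oriented network). For `0 ≤ r < 1` and `p` the greatest lower bound of `{q | 0 < θ⁺(q,r)}` with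
`p·r < p_c(ℤ³)`: if `(p,r)` is uniformly time-like then `θ⁺(p,r) = 0`. Route: assume `θ⁺(p,r) > 0`;
finite-size criterion at the SAME `p` (seeds from the infinite forward cluster; blocks with
`C' log L` collars, never re-entered by the union bound from uniform time-likeness); continuity of
the finite-box criterion in `p`; sufficiency by dynamic renormalisation ⟹ `θ⁺(p',r) > 0` for some
`p' < p`, against the lower bound. A consequence of the crux (`coneSteering_of_backboneSteering`).
[GrimmettHiemer2002 Thm 1; BezuidenhoutGrimmett1990; BarskyGrimmettNewman1991; GrimmettHolroyd2010
Prop 7; Liggett2005] -/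
theorem stub_coneSteering :
    let θ : ℝ → ℝ → ℝ := fun p r => (labelMeasure (Site 3)).real
      {U | {y : Site 3 | Relation.ReflTransGen
        (fun u v : Site 3 => (u ⋖ v ∧ U s(u, v) ≤ p) ∨ (v ⋖ u ∧ U s(u, v) ≤ p * r)) 0 y}.Infinite}
    let D : ℝ → ℝ → Site 3 → ℕ → Set (Sym2 (Site 3) → ℝ) := fun p r x n =>
      {U | ∃ y : Site 3, Relation.ReflTransGen
        (fun u v : Site 3 => (u ⋖ v ∧ U s(u, v) ≤ p) ∨ (v ⋖ u ∧ U s(u, v) ≤ p * r)) x y ∧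
        (∑ i, y i) + n ≤ ∑ i, x i}
    ∀ r : ℝ, 0 ≤ r → r < 1 → ∀ p : ℝ, IsGLB {q : ℝ | 0 < θ q r} p →
      p * r < criticalProb (zdGraph 3) 0 →
      (∃ C c : ℝ, 0 < c ∧ ∀ (x : Site 3) (n : ℕ),
        (labelMeasure (Site 3)).real (D p r x n) ≤ C * Real.exp (-(c * n))) →
      θ p r = 0 := by
  sorry

/-- Definitional consistency: the registered STUB 1 proves its name-keyed statement. -/
theorem timeLikeCone_registered : Sig.stub_timeLikeCone := stub_timeLikeCone

/-- Definitional consistency: the registered STUB 2 proves its name-keyed statement. -/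
theorem coneSteering_registered : Sig.stub_coneSteering := stub_coneSteering

/-! ## §3 Proved plumbing -/

/-! ### Monotonicity in `p` (so STUB 1 at `p_c(r)` is time-likeness on the whole segment below) -/

theorem step_mono {p p' r : ℝ} (hp : p ≤ p') (hr : 0 ≤ r) (U : Labels 3) {u v : Site 3}
    (h : step p r U u v) : step p' r U u v := by
  rcases h with ⟨huv, hU⟩ | ⟨hvu, hU⟩
  · exact Or.inl ⟨huv, hU.trans hp⟩
  · exact Or.inr ⟨hvu, hU.trans (mul_le_mul_of_nonneg_right hp hr)⟩

theorem backEvent_mono {p p' r : ℝ} (hp : p ≤ p') (hr : 0 ≤ r) (x : Site 3) (n : ℕ) :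
    backEvent p r x n ⊆ backEvent p' r x n := by
  rintro U ⟨y, hy, hh⟩
  exact ⟨y, Relation.ReflTransGen.mono (fun u v h => step_mono hp hr U h) x y hy, hh⟩

theorem timeLike_anti {p p' r : ℝ} (hp : p ≤ p') (hr : 0 ≤ r) (h : TimeLike p' r) : TimeLike p r := by
  obtain ⟨C, c, hc, hn⟩ := h
  refine ⟨C, c, hc, fun n => (measureReal_mono (backEvent_mono hp hr 0 n) ?_).trans (hn n)⟩
  have := isProbabilityMeasure_labelMeasure (Site 3)
  exact measure_ne_top _ _

/-! ### Translation invariance of the RDN law: `TimeLike → UniformTimeLike` -/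

/-- The height is additive. -/
theorem height_add (y v : Site 3) : height (y + v) = height y + height v := by
  simp [height, Finset.sum_add_distrib]

@[simp] theorem height_zero : height 0 = 0 := by simp [height]

/-- The bond bijection induced by translation by `v`. -/
abbrev bondShift (v : Site 3) : Sym2 (Site 3) ≃ Sym2 (Site 3) := sym2Equiv (Site.shift v)

/-- Relabelling the labels along translation by `v`: `(shiftLabels v U) s(a,b) = U s(a+v, b+v)`. -/
def shiftLabels (v : Site 3) (U : Labels 3) : Labels 3 := fun e => U (bondShift v e)

@[simp] theorem shiftLabels_mk (v : Site 3) (U : Labels 3) (a b : Site 3) :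
    shiftLabels v U s(a, b) = U s(a + v, b + v) := rfl

/-- Covering is translation invariant on `ℤ³`. -/
theorem covBy_add_right_iff (a b v : Site 3) : a + v ⋖ b + v ↔ a ⋖ b := by
  simp only [Site.covBy_iff, add_right_comm _ v, add_left_inj]

theorem step_shiftLabels (p r : ℝ) (v : Site 3) (U : Labels 3) (a b : Site 3) :
    step p r (shiftLabels v U) a b ↔ step p r U (a + v) (b + v) := by
  simp only [step, shiftLabels_mk, covBy_add_right_iff]

/-- Forward reach is equivariant under lattice shifts. -/
theorem reach_shiftLabels (p r : ℝ) (v : Site 3) (U : Labels 3) (a b : Site 3) :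
    reach p r (shiftLabels v U) a b ↔ reach p r U (a + v) (b + v) := by
  constructor
  · intro h
    exact Relation.ReflTransGen.lift (· + v) (fun x y hxy => (step_shiftLabels p r v U x y).1 hxy) a b h
  · intro h
    have h' : reach p r (shiftLabels v U) (a + v - v) (b + v - v) :=
      Relation.ReflTransGen.lift (fun x => x - v)
        (fun x y hxy => by
          show step p r (shiftLabels v U) (x - v) (y - v)
          rw [step_shiftLabels, sub_add_cancel, sub_add_cancel]
          exact hxy) (a + v) (b + v) h
    simpa using h'

/-- The excursion event from `v` is the relabelled excursion event from the origin. -/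
theorem backEvent_eq_preimage (p r : ℝ) (v : Site 3) (n : ℕ) :
    backEvent p r v n = shiftLabels v ⁻¹' backEvent p r 0 n := by
  ext U
  simp only [backEvent, Set.mem_preimage, Set.mem_setOf_eq, reach_shiftLabels, zero_add, height_zero]
  constructor
  · rintro ⟨y, hy, hh⟩
    refine ⟨y - v, by simpa using hy, ?_⟩
    have hsum := height_add (y - v) v
    rw [sub_add_cancel] at hsum
    linarith
  · rintro ⟨y, hy, hh⟩
    exact ⟨y + v, hy, by rw [height_add]; linarith⟩

/-- The relabelling is the measurable equivalence `piCongrLeft` along `(bondShift v).symm`. -/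
theorem shiftLabels_eq_piCongrLeft (v : Site 3) :
    (shiftLabels v : Labels 3 → Labels 3) =
      ⇑(MeasurableEquiv.piCongrLeft (fun _ : Sym2 (Site 3) => ℝ) (bondShift v).symm) := by
  funext U e
  simp [shiftLabels, MeasurableEquiv.coe_piCongrLeft, Equiv.piCongrLeft_apply_eq_cast]

/-- The i.i.d. labels are invariant under the relabelling (`labelMeasure_map_comp_equiv`). -/
theorem map_shiftLabels (v : Site 3) : μ.map (shiftLabels v) = μ := by
  have h := labelMeasure_map_comp_equiv (d := 3) (bondShift v).symm
  simp only [Equiv.symm_symm] at h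
  exact h

/-- **Translation invariance**: the excursion probability does not depend on the base point
(no measurability needed: the relabelling is a measurable equivalence). -/
theorem measure_backEvent_shift (p r : ℝ) (v : Site 3) (n : ℕ) :
    μ (backEvent p r v n) = μ (backEvent p r 0 n) := by
  rw [backEvent_eq_preimage, shiftLabels_eq_piCongrLeft, ← MeasurableEquiv.map_apply,
    ← shiftLabels_eq_piCongrLeft, map_shiftLabels]

theorem measureReal_backEvent_shift (p r : ℝ) (v : Site 3) (n : ℕ) :
    μ.real (backEvent p r v n) = μ.real (backEvent p r 0 n) := by
  simp only [measureReal_def, measure_backEvent_shift]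

/-- Time-likeness at the origin is uniform time-likeness (same constants). -/
theorem uniformTimeLike_of_timeLike {p r : ℝ} (h : TimeLike p r) : UniformTimeLike p r := by
  obtain ⟨C, c, hc, hn⟩ := h
  exact ⟨C, c, hc, fun x n => by rw [measureReal_backEvent_shift]; exact hn n⟩

theorem uniformTimeLike_iff (p r : ℝ) : UniformTimeLike p r ↔ TimeLike p r :=
  ⟨fun ⟨C, c, hc, h⟩ => ⟨C, c, hc, fun n => h 0 n⟩, uniformTimeLike_of_timeLike⟩

/-! ### Honest-piece check: STUB 2 is a consequence of the crux -/

theorem thetaRD_nonneg (p r : ℝ) : 0 ≤ thetaRD p r := measureReal_nonneg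

/-- The crux implies STUB 2 (the crux weakened by the time-likeness hypothesis): at a greatest lower
bound `p` of the percolating parameters with `p·r < p_c`, a percolating `p` would be undercut. -/
theorem coneSteering_of_backboneSteering (h : BackboneSteering) : ConeSteering := by
  rw [backboneSteering_iff] at h
  intro r hr0 hr1 p hp hpr _
  by_contra hne
  have hpos : 0 < thetaRD p r := lt_of_le_of_ne (thetaRD_nonneg p r) (Ne.symm hne)
  obtain ⟨p', hp', hθ'⟩ := h r hr0 hr1 p hpr hpos
  exact absurd (hp.1 hθ') (not_le.mpr hp')

/-! ## §4 The composition, by name -/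

/-- **`BackboneSteering_of`**: the two registered stubs imply the crux
`Summit.CriticalPhenomena.PercolationContinuityZ3.Theses.PercDiodeSteering.BackboneSteering`
(kernel-checked; no `sorry` outside the stubs). If `0 < θ⁺(p,r)` but no `p' < p` percolates, then
`p` is a greatest lower bound of `{q | 0 < θ⁺(q,r)}`; STUB 1 gives time-likeness, translation
invariance (proved) makes it uniform, STUB 2 gives `θ⁺(p,r) = 0`: contradiction. -/
theorem BackboneSteering_of (hT : Sig.stub_timeLikeCone) (hS : Sig.stub_coneSteering) :
    Summit.CriticalPhenomena.PercolationContinuityZ3.Theses.PercDiodeSteering.BackboneSteering := by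
  have hT' : TimeLikeCone := Sig.stub_timeLikeCone_iff.1 hT
  have hS' : ConeSteering := Sig.stub_coneSteering_iff.1 hS
  rw [backboneSteering_iff]
  intro r hr0 hr1 p hpr hθ
  by_contra H
  push Not at H
  -- `p` is a member and a lower bound of the percolating set, hence its greatest lower bound
  have hcrit : IsCritical p r := by
    refine ⟨fun q hq => ?_, fun b hb => hb hθ⟩
    by_contra hlt
    push Not at hlt
    exact absurd hq (not_lt.mpr (H q hlt))
  have hTL : UniformTimeLike p r := uniformTimeLike_of_timeLike (hT' r hr0 hr1 p hcrit hpr)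
  exact absurd (hS' r hr0 hr1 p hcrit hpr hTL) hθ.ne'

/-- Wiring check: the registered stubs feed `BackboneSteering_of` as stated. -/
example : Summit.CriticalPhenomena.PercolationContinuityZ3.Theses.PercDiodeSteering.BackboneSteering :=
  BackboneSteering_of stub_timeLikeCone stub_coneSteering

end Summit.CriticalPhenomena.PercolationContinuityZ3.Cruxes.BackboneSteering.Birth

end
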